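import Literature.MathematicalPhysics.PowerSystems.DCFlowLineOutageFactor
import Literature.MathematicalPhysics.PowerSystems.LaplacianEdgeAddition
import Literature.Probability.MarkovChains.DirichletPrinciple
import Literature.Analysis.Matrix.EigenvaluesPositiveScaling
import HarnessLib

/-!
# Losing one line: Dirichlet's principle as `(x_a − x_b)² ≤ 𝓡(a ↔ b)·xᵀLx`, the single-edge case of
# Spielman–Srivastava's Lemma 4 — `(1 − c(r,s)𝓡(r ↔ s))·L ⪯ L − c(r,s)ν_rsν_rsᵀ ⪯ L` — every sorted
# Laplacian eigenvalue pinched, and the algebraic connectivity after an N−1 line contingency bounded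
# from the INTACT network (`λ₂` and one effective resistance); screening rule for synchronization
# condition II

Topic `Literature/MathematicalPhysics/PowerSystems`; namespaces `…PowerSystems.KronReduction` (§1–§3,
conductance-network vocabulary) and `…PowerSystems` (§4, the coupling Laplacian `diag(a𝟙) − a` on
`Fin n` of the synchronization files).  Sequel of `DCFlowLineOutageFactor.lean` (transfer potentials,
`effectiveResistance_eq_transferPotential_sub`, the self-factor `c(r,s)𝓡(r ↔ s) ≤ 1` / `< 1` off
bridges, `ClassicalModel.laplacian_lineOutage_eq`), BY NAME over `LaplacianEdgeAddition`
(`laplacian_edgeAddition_eigenvalues₀`, Van Mieghem (4.111)–(4.112)), `KronReductionSpectralInterlacing`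
(`eigenvalues₀_mono_of_form_le`, Loewner ⇒ per index), `LaplacianAlgebraicConnectivity`
(`laplacian_eigenvalues₀_pos_of_connected`, `couplingLaplacian_laplacian`),
`Literature/Analysis/Matrix/EigenvaluesPositiveScaling` (`eigenvalues₀_smul_of_nonneg`) and
`Literature/Probability/MarkovChains/DirichletPrinciple` (`LyonsPeres2016_ex_2_13`).  Everything below
is PROVED: 0 definitions, 0 named facts, 0 `sorry`, no new axiom.

SOURCES (read on the page).
* [SpielmanSrivastava2011] D. A. Spielman, N. Srivastava, *Graph sparsification by effective
  resistances*, SIAM J. Comput. 40 (2011) (`lit read paper:arxiv-0803.0929`).  §3 (p0006 L1–L11):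
  «Consider the matrix `Π = W^{1/2}BL†BᵀW^{1/2}`. Since we know `BL⁺Bᵀ(e,e) = R_e`, the diagonal
  entries of `Π` are `Π(e,e) = w_eR_e`», Lemma 3 «(i) `Π` is a projection matrix … (iv) `Π(e,e) =
  ‖Π(·,e)‖²`»; Lemma 4 (p0006 L76–L112): «Suppose `S` is a nonnegative diagonal matrix such that
  `‖ΠSΠ − ΠΠ‖₂ ≤ ε`. Then `∀x ∈ ℝⁿ (1 − ε)xᵀLx ≤ xᵀL̃x ≤ (1 + ε)xᵀLx`, where `L = BᵀWB` and `L̃ =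
  BᵀW^{1/2}SW^{1/2}B`».  SPECIALISATION typed here: `S = I − e_ee_eᵀ` (the one line `e = {r,s}`
  switched off) gives `L̃ = L − w_e b_e b_eᵀ` and `ΠSΠ − ΠΠ = −Π(·,e)Π(·,e)ᵀ` of norm `‖Π(·,e)‖² =
  Π(e,e) = w_eR_e` — so `ε = w_eR_e = c(r,s)𝓡(r ↔ s)`; the upper half is replaced by the trivially
  sharper `L̃ ⪯ L`.
* [LyonsPeres2016] R. Lyons, Y. Peres, *Probability on Trees and Networks*, CUP 2016, §2.4
  Exercise 2.13 (Dirichlet's principle `𝒞(a ↔ z) = min{𝓔(c·dF) : F(a) = 1, F(z) = 0}`) — the tree's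
  `DirichletPrinciple.lean`, by name.
* [VanMieghem2010] P. Van Mieghem, *Graph Spectra for Complex Networks*, CUP 2010, §4.7 art.
  163–164 eqs. (4.111)–(4.112) (held text p0179): adding one link raises every Laplacian eigenvalue
  by at most `2` (weighted: `2Δ`) with interlacing — the tree's `LaplacianEdgeAddition.lean`, read
  backwards (`L = L' + c(r,s)νν^ᵀ`).
* [DorflerBullo2012] F. Dörfler, F. Bullo, SIAM J. Control Optim. 50 (2012), arXiv:0910.5673 §5.2
  Thm 5.5 / Lemma 5.9 («if `λ₂(L(Pᵢⱼ cos φᵢⱼ)) > λ_critical`»; the certificate hypothesis `λ ≤ λ₂`),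
  §2 (p0005 L32–L38, `ker L(aᵢⱼ) = span 𝟙` for a connected graph) — through
  `NonuniformKuramotoSpectralSyncCondition` / `LaplacianAlgebraicConnectivity`.
* [HornJohnson2013] Cor. 4.3.12 (Loewner monotonicity of sorted eigenvalues), Thm 1.1.6 (scaling) —
  through the imported tree files.

RENDERING.  As in `DCFlowLineOutageFactor`: `c : Matrix X X ℝ` with `IsConductance c`,
`L = diagonal (nodeConductance c) − c`, graph hypothesis `G.Adj x y ↔ x ≠ y ∧ c x y ≠ 0`, connected;
the removed line `{r,s}`, `r ≠ s`, `c r s ≠ 0`; `L'` abstract with `hL' : L' = L − c r s • vecMulVec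
ν_rs ν_rs` (`ν_rs = Pi.single r 1 − Pi.single s 1`); eigenvalues = Mathlib's DECREASING `eigenvalues₀`,
`λ₂ = eigenvalues₀ ⟨card − 2⟩`; «non-bridge» = `r, s` reachable in some graph of lines other than
`{r,s}`.  §4: weights `a : Fin n → Fin n → ℝ`, `L(a) = diagonal (fun i => ∑ j, a i j) − Matrix.of a`,
the damaged weights `a'` by an explicit `if`, `𝓡 = effectiveResistance (Matrix.of a) r s`.

WHAT IS PROVED (0 `def`, 0 named facts, 0 `sorry`).
* §1 ★★★ **`sub_sq_le_effectiveResistance_mul_form`** (`(x_a − x_b)² ≤ 𝓡(a ↔ b)·xᵀLx` for all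
  `x`, `a ≠ b` — Dirichlet's principle as the matrix inequality `(e_a − e_b)(e_a − e_b)ᵀ ⪯ 𝓡·L`);
  ★★ `transferPotential_form_eq` (equality at any transfer potential: `vᵀLv = 𝓡 = v_a − v_b`).
* §2 ★★★ **`lineOutage_form_sandwich`** (`(1 − c(r,s)𝓡)·xᵀLx ≤ xᵀL'x ≤ xᵀLx` — Lemma 4 for one
  deleted line); ★★★ **`lineOutage_eigenvalues₀`** (for EVERY sorted index `k`: `(1 − c(r,s)𝓡)λ↓_k(L)
  ≤ λ↓_k(L') ≤ λ↓_k(L)`, `λ↓_k(L) − 2c(r,s) ≤ λ↓_k(L')`, `λ↓_{k+1}(L) ≤ λ↓_k(L')`).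
* §3 ★★★ **`lineOutage_algConn`** (`(1 − c(r,s)𝓡)λ₂(L) ≤ λ₂(L') ≤ λ₂(L)`, `λ₂(L) > 0`, and for a
  non-bridge `c(r,s)𝓡 < 1 ∧ λ₂(L') > 0`); ★★ `le_lineOutage_algConn_of_le` (SCREENING: `λ ≤ (1 −
  c(r,s)𝓡)λ₂(L) ⇒ λ ≤ λ₂(L')`).
* §4 THE MODEL: ★ `isConductance_of_connected_weights`; ★★★ **`couplingLaplacian_lineOutage_algConn`**
  (the same for the coupling Laplacian `L(a)` on `Fin n` with the pair `{r,s}` switched off: `λ₂`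
  sandwich with `λ₂(L(a)) > 0`, every mode pinched, and the screening rule in the `λ ≤ λ₂(L(a'))`
  currency of ★ `two_norm_cohesive_of_le_algConn` / `frequency_sync_of_le_algConn` /
  `DroopNetwork.two_norm_cohesive_of_le_algConn`).

PROOF ROUTE.  §1: `xᵀLx = 𝓔(c·dx)` ((9.22)); for `x_a ≠ x_b` normalise `F = (x − x_b)/(x_a − x_b)`,
`𝓔(c·dF) = 𝓔(c·dx)/(x_a − x_b)²`, and Exercise 2.13 gives `1/𝓡 ≤ 𝓔(c·dF)`.  §2: `xᵀL'x = xᵀLx −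
c(r,s)(x_r − x_s)²` and §1; then Loewner monotonicity per sorted index (HJ 4.3.12) for
`(1 − c𝓡)·L ⪯ L'` and `L' ⪯ L`, positive scaling of the spectrum (`1 − c𝓡 ≥ 0` by
`conductance_mul_effectiveResistance_le_one`), and Van Mieghem's one-link interlacing by name for
`L = L' + c(r,s)νν^ᵀ`.  §3: weighted Fiedler (`λ₂(L) > 0`, connected) and the non-bridge self-factor
`< 1`.  §4: a connected coupling graph on `n ≥ 2` nodes has a neighbour at every node, hence is an
`IsConductance` network; `L(a') = L(a) − aᵣₛνν^ᵀ` is `ClassicalModel.laplacian_lineOutage_eq`; the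
`Fin n` coupling Laplacian is definitionally the conductance Laplacian of `Matrix.of a`.  In-seat
cross-check (`negtest/lineoutage_algconn_check.py`, seat folder / HOME/lean/lit-1/): exact `Fraction`s
for the Dirichlet bound on random rational vectors, equality at transfer potentials, the form
downdate and the sandwich; floating Jacobi eigenvalues for the pinching, the `2c(r,s)` shift, the
interlacing and `λ₂(L') > 0 ⟺` non-bridge on 50 random networks (3–7 nodes, every line) — 22 389
checks, 0 failures.

THREE COLUMNS.  CERTIFIED (kernel theorems, exact data): the quadratic-form Dirichlet bound; the
sandwich `(1 − c(r,s)𝓡(r ↔ s))L ⪯ L' ⪯ L`; all sorted-eigenvalue consequences incl.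
`(1 − c𝓡)λ₂(L) ≤ λ₂(L') ≤ λ₂(L)`, positivity off bridges, the screening implication.  MODELLED (§4
docstring): oscillator networks whose coupling graph is the line graph (first-order non-uniform
Kuramoto; lossless all-inverter droop network with `aᵢⱼ = EᵢEⱼ|Yᵢⱼ|`) — there an N−1 line outage
deletes one coupling; for NETWORK-REDUCED swing models a physical line outage is instead the dense
rank-one update of `kronReducedSusceptance_eigenvalues₀_line_outage` (★ G84), not covered by §4's
reading.  VALIDATED: nothing numerical in Lean.  NOT CLAIMED: sharpness of the factor `1 − c𝓡` for
`λ₂` (it is sharp for the FORM, attained at the transfer potential, not for `λ₂` in general); the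
random-sampling content of [SpielmanSrivastava2011] (Theorem 1, Lemma 5); several simultaneous
outages (iterate, or Lemma 4 with a general `S`); any statement that a grid «is stable».

## References
* [SpielmanSrivastava2011] D. A. Spielman, N. Srivastava, *Graph sparsification by effective
  resistances*, SIAM J. Comput. 40(6) (2011) 1913–1926, arXiv:0803.0929 — §3 Lemma 3, Lemma 4.
* [LyonsPeres2016] R. Lyons, Y. Peres, *Probability on Trees and Networks*, CUP 2016 — §2.4
  Exercise 2.13.
* [VanMieghem2010] P. Van Mieghem, *Graph Spectra for Complex Networks*, CUP 2010 — §4.7 art.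
  163–164, eqs. (4.111)–(4.112).
* [DorflerBullo2012] F. Dörfler, F. Bullo, *Synchronization and transient stability in power networks
  and non-uniform Kuramoto oscillators*, SIAM J. Control Optim. 50 (2012), arXiv:0910.5673 — §2,
  §5.2 Thm 5.5, Lemma 5.9.
* [HornJohnson2013] R. A. Horn, C. R. Johnson, *Matrix Analysis*, 2nd ed., CUP 2013 — Cor. 4.3.12,
  Thm 1.1.6.
* [LevinPeres2017] D. A. Levin, Y. Peres, *Markov Chains and Mixing Times*, 2nd ed., AMS 2017 —
  §9.4 eq. (9.22), Thm 9.10.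
-/

noncomputable section

open scoped Matrix
open Finset Matrix

namespace Literature.MathematicalPhysics.PowerSystems

namespace KronReduction

open Literature.Probability.MarkovChains Literature.Analysis.Matrix.EigenvalueCount

variable {X : Type*} [Fintype X] [DecidableEq X] {c : Matrix X X ℝ}

/-! ### §1. Dirichlet's principle in quadratic-form form: `(x_a − x_b)² ≤ 𝓡(a ↔ b)·xᵀLx`, with
equality at the transfer potentials -/

section Dirichlet

/-- `(L v)_x = Σ_y c(x,y)(v_x − v_y)`. [folklore] -/
private theorem laplacian_mulVec₁₂ (c : Matrix X X ℝ) (v : X → ℝ) (x : X) :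
    ((Matrix.diagonal (nodeConductance c) - c) *ᵥ v) x = ∑ y, c x y * (v x - v y) := by
  rw [Matrix.sub_mulVec, Pi.sub_apply, Matrix.mulVec_diagonal, nodeConductance_def, Matrix.mulVec,
    dotProduct, Finset.sum_mul, ← Finset.sum_sub_distrib]
  exact Finset.sum_congr rfl fun y _ => by ring

/-- The Laplacian form is the Dirichlet energy of the potential: `xᵀLx = 𝓔(c·dx)
(= ½ΣΣ c(i,j)(x_i − x_j)²)`. [folklore] -/
private theorem laplacian_form_eq_energy₁₂ (hc : IsConductance c) (x : X → ℝ) :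
    x ⬝ᵥ (Matrix.diagonal (nodeConductance c) - c) *ᵥ x = flowEnergy c (currentFlow c x) := by
  rw [flowEnergy_currentFlow_eq_sum hc, dotProduct]
  exact Finset.sum_congr rfl fun i _ => by rw [flowDiv_def, laplacian_mulVec₁₂]; rfl

/-- The network Laplacian is symmetric with `−c` off the diagonal and zero row sums. [folklore] -/
private theorem laplacian_props₁₂ (hc : IsConductance c) :
    (Matrix.diagonal (nodeConductance c) - c).IsHermitian
    ∧ (∀ x y, x ≠ y → (Matrix.diagonal (nodeConductance c) - c) x y ≤ 0)
    ∧ (∀ x, ∑ y, (Matrix.diagonal (nodeConductance c) - c) x y = 0) := by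
  have hoff : ∀ x y, x ≠ y → (Matrix.diagonal (nodeConductance c) - c) x y = -c x y :=
    fun x y hxy => by rw [Matrix.sub_apply, Matrix.diagonal_apply_ne _ hxy, zero_sub]
  refine ⟨?_, fun x y hxy => ?_, fun x => ?_⟩
  · refine Matrix.IsHermitian.ext fun x y => ?_
    by_cases hxy : x = y
    · subst hxy; simp
    · rw [star_trivial, hoff y x (Ne.symm hxy), hoff x y hxy, hc.symm x y]
  · rw [hoff x y hxy, neg_nonpos]; exact hc.nonneg x y
  · have h : ∑ y, (Matrix.diagonal (nodeConductance c) - c) x y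
        = ((Matrix.diagonal (nodeConductance c) - c) *ᵥ fun _ => (1 : ℝ)) x := by
      simp [Matrix.mulVec, dotProduct]
    rw [h, laplacian_mulVec₁₂]
    simp

/-- ★★★ **DIRICHLET'S PRINCIPLE AS A QUADRATIC-FORM BOUND**: on a connected conductance network,
for every potential `x` and every pair `a ≠ b`: `(x_a − x_b)² ≤ 𝓡(a ↔ b)·xᵀLx` — the effective
CONDUCTANCE `1/𝓡(a ↔ b)` is the least Dirichlet energy `𝓔(c·dF)` over `F(a) = 1, F(b) = 0`
(normalise `F = (x − x_b)/(x_a − x_b)`).  This is the matrix inequality `(e_a − e_b)(e_a − e_b)ᵀ ⪯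
𝓡(a ↔ b)·L` behind «`Π(e,e) = w_eR_e`», `Π` a projection.
[cite: LyonsPeres2016, §2.4 Exercise 2.13 (Dirichlet's principle, `𝒞(a ↔ z) = min{𝓔(c dF) : F(a) = 1, F(z) = 0}`); SpielmanSrivastava2011, §3 Lemma 3 (arXiv:0803.0929 p0006 L4–L11)] -/
theorem sub_sq_le_effectiveResistance_mul_form (hc : IsConductance c) {G : SimpleGraph X}
    (hG : ∀ x y, G.Adj x y ↔ x ≠ y ∧ c x y ≠ 0) (hconn : G.Connected) {a b : X} (hab : a ≠ b)
    (x : X → ℝ) :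
    (x a - x b) ^ 2
      ≤ effectiveResistance c a b * (x ⬝ᵥ (Matrix.diagonal (nodeConductance c) - c) *ᵥ x) := by
  have hirr := isIrreducible_networkKernel_of_connected hc hG hconn
  have hRpos := effectiveResistance_pos hc hirr hab
  have hform : 0 ≤ x ⬝ᵥ (Matrix.diagonal (nodeConductance c) - c) *ᵥ x := by
    rw [laplacian_form_eq_energy₁₂ hc]; exact flowEnergy_nonneg hc.nonneg _
  by_cases hxab : x a = x b
  · rw [hxab, sub_self, zero_pow two_ne_zero]; exact mul_nonneg hRpos.le hform
  · have hd : x a - x b ≠ 0 := sub_ne_zero.2 hxab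
    set F : X → ℝ := fun y => (x y - x b) / (x a - x b) with hF
    have hFa : F a = 1 := by simp only [hF]; exact div_self hd
    have hFb : F b = 0 := by simp only [hF, sub_self, zero_div]
    have hD := LyonsPeres2016_ex_2_13 hc hirr hab hFa hFb
    -- `𝓔(c·dF) = 𝓔(c·dx)/(x_a − x_b)²`
    have hscale : flowEnergy c (currentFlow c F) = flowEnergy c (currentFlow c x) / (x a - x b) ^ 2 := by
      rw [flowEnergy_currentFlow_eq_dirichlet, flowEnergy_currentFlow_eq_dirichlet, mul_div_assoc]
      congr 1
      rw [Finset.sum_div]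
      refine Finset.sum_congr rfl fun i _ => ?_
      rw [Finset.sum_div]
      refine Finset.sum_congr rfl fun j _ => ?_
      simp only [hF]
      rw [div_sub_div_same, div_pow]
      ring
    rw [hscale, ← laplacian_form_eq_energy₁₂ hc, le_div_iff₀ (by positivity)] at hD
    -- `1/𝓡 · (x_a − x_b)² ≤ xᵀLx`
    calc (x a - x b) ^ 2 = effectiveResistance c a b * (1 / effectiveResistance c a b * (x a - x b) ^ 2) := by
          field_simp
      _ ≤ effectiveResistance c a b * (x ⬝ᵥ (Matrix.diagonal (nodeConductance c) - c) *ᵥ x) :=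
          mul_le_mul_of_nonneg_left hD hRpos.le

/-- ★★ **… WITH EQUALITY AT THE TRANSFER POTENTIALS**: if `L v = e_a − e_b` (`a ≠ b`) then
`vᵀLv = 𝓡(a ↔ b) = v_a − v_b`, so `(v_a − v_b)² = 𝓡(a ↔ b)·vᵀLv` — the energy of the unit transfer is
the effective resistance (Thomson), and `𝓡(a ↔ b) = max_x (x_a − x_b)²/xᵀLx`.
[cite: LyonsPeres2016, §2.4 Exercise 2.13 (the minimum is attained at the harmonic function); LevinPeres2017, §9.4 Thm 9.10 (`𝓔(I) = 𝓡(a ↔ z)`)] -/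
theorem transferPotential_form_eq (hc : IsConductance c) {G : SimpleGraph X}
    (hG : ∀ x y, G.Adj x y ↔ x ≠ y ∧ c x y ≠ 0) (hconn : G.Connected) {a b : X} (hab : a ≠ b)
    {v : X → ℝ} (hv : (Matrix.diagonal (nodeConductance c) - c) *ᵥ v = Pi.single a 1 - Pi.single b 1) :
    v ⬝ᵥ (Matrix.diagonal (nodeConductance c) - c) *ᵥ v = effectiveResistance c a b
    ∧ (v a - v b) ^ 2 = effectiveResistance c a b * (v ⬝ᵥ (Matrix.diagonal (nodeConductance c) - c) *ᵥ v) := by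
  have hR := effectiveResistance_eq_transferPotential_sub hc hG hconn hab hv
  have h1 : v ⬝ᵥ (Matrix.diagonal (nodeConductance c) - c) *ᵥ v = v a - v b := by
    rw [hv, dotProduct_sub, dotProduct_single_one, dotProduct_single_one]
  refine ⟨by rw [h1, hR], ?_⟩
  rw [h1, ← hR, sq]

end Dirichlet

/-! ### §2. Deleting one line: `(1 − c(r,s)·𝓡(r ↔ s))·L ⪯ L' ⪯ L` (Spielman–Srivastava Lemma 4 with
`S = 1 − e_ee_eᵀ`), every sorted eigenvalue, and the algebraic connectivity -/

section Sandwich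

/-- `ν_rsᵀx = x_r − x_s`. [folklore] -/
private theorem nu_dotProduct₁₂ (r s : X) (x : X → ℝ) :
    (Pi.single r (1 : ℝ) - Pi.single s 1) ⬝ᵥ x = x r - x s := by
  rw [sub_dotProduct, single_one_dotProduct, single_one_dotProduct]

/-- `xᵀν_rs = x_r − x_s`. [folklore] -/
private theorem dotProduct_nu₁₂ (r s : X) (x : X → ℝ) :
    x ⬝ᵥ (Pi.single r (1 : ℝ) - Pi.single s 1) = x r - x s := by
  rw [dotProduct_sub, dotProduct_single_one, dotProduct_single_one]

/-- Equal matrices have equal sorted spectra. [folklore] -/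
private theorem eigenvalues₀_congr₁₂ {A B : Matrix X X ℝ} (hA : A.IsHermitian) (hB : B.IsHermitian)
    (h : A = B) : hA.eigenvalues₀ = hB.eigenvalues₀ := by
  subst h; rfl

/-- `xᵀ(L − wνν^ᵀ)x = xᵀLx − w(x_r − x_s)²`. [folklore] -/
private theorem form_lineOutage₁₂ {r s : X} {w : ℝ} {L L' : Matrix X X ℝ}
    (hL' : L' = L - w • Matrix.vecMulVec (Pi.single r (1 : ℝ) - Pi.single s 1) (Pi.single r (1 : ℝ) - Pi.single s 1))
    (x : X → ℝ) : x ⬝ᵥ L' *ᵥ x = x ⬝ᵥ L *ᵥ x - w * (x r - x s) ^ 2 := by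
  have hrk : (w • Matrix.vecMulVec (Pi.single r (1 : ℝ) - Pi.single s 1) (Pi.single r (1 : ℝ) - Pi.single s 1)) *ᵥ x
      = (w * (x r - x s)) • (Pi.single r (1 : ℝ) - Pi.single s 1) := by
    funext y
    rw [Matrix.smul_mulVec, Pi.smul_apply, Pi.smul_apply, smul_eq_mul, smul_eq_mul, Matrix.mulVec,
      dotProduct]
    simp_rw [Matrix.vecMulVec_apply, mul_assoc, ← Finset.mul_sum]
    rw [← dotProduct, nu_dotProduct₁₂]
    ring
  rw [hL', Matrix.sub_mulVec, dotProduct_sub, hrk, dotProduct_smul, dotProduct_nu₁₂, smul_eq_mul, sq,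
    mul_assoc]

/-- ★★★ **DELETING ONE LINE COSTS AT MOST THE FACTOR `1 − c(r,s)·𝓡(r ↔ s)` OF THE LAPLACIAN FORM**
(Spielman–Srivastava Lemma 4, «Suppose `S` is a nonnegative diagonal matrix such that `‖ΠSΠ − ΠΠ‖₂
≤ ε`. Then `∀x (1 − ε)xᵀLx ≤ xᵀL̃x ≤ (1 + ε)xᵀLx`», specialised to `S = 1 − e_ee_eᵀ` — the line
`e = {r,s}` switched off, `L̃ = L − c(r,s)ν_rsν_rsᵀ` — where `ε = ‖Π(·,e)‖² = Π(e,e) = w_eR_e` by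
Lemma 3 (iv)): on a connected conductance network, for every `x`,
`(1 − c(r,s)𝓡(r ↔ s))·xᵀLx ≤ xᵀL'x ≤ xᵀLx`.  (The upper bound is the trivial direction `L' ⪯ L`.)
[cite: SpielmanSrivastava2011, §3 Lemma 4 with Lemma 3 (iv) and «`Π(e,e) = w_eR_e`» (arXiv:0803.0929 p0006 L4–L11, L76–L112); LyonsPeres2016, §2.4 Exercise 2.13] -/
theorem lineOutage_form_sandwich (hc : IsConductance c) {G : SimpleGraph X}
    (hG : ∀ x y, G.Adj x y ↔ x ≠ y ∧ c x y ≠ 0) (hconn : G.Connected) {r s : X} (hrs : r ≠ s)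
    {L' : Matrix X X ℝ}
    (hL' : L' = (Matrix.diagonal (nodeConductance c) - c)
        - c r s • Matrix.vecMulVec (Pi.single r (1 : ℝ) - Pi.single s 1) (Pi.single r (1 : ℝ) - Pi.single s 1))
    (x : X → ℝ) :
    (1 - c r s * effectiveResistance c r s) * (x ⬝ᵥ (Matrix.diagonal (nodeConductance c) - c) *ᵥ x)
        ≤ x ⬝ᵥ L' *ᵥ x
      ∧ x ⬝ᵥ L' *ᵥ x ≤ x ⬝ᵥ (Matrix.diagonal (nodeConductance c) - c) *ᵥ x := by
  rw [form_lineOutage₁₂ hL']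
  have h1 := sub_sq_le_effectiveResistance_mul_form hc hG hconn hrs x
  have hc0 : 0 ≤ c r s := hc.nonneg r s
  have h2 : c r s * (x r - x s) ^ 2
      ≤ c r s * (effectiveResistance c r s * (x ⬝ᵥ (Matrix.diagonal (nodeConductance c) - c) *ᵥ x)) :=
    mul_le_mul_of_nonneg_left h1 hc0
  refine ⟨by linarith, ?_⟩
  linarith [mul_nonneg hc0 (sq_nonneg (x r - x s))]

/-- ★★★ **EVERY SORTED LAPLACIAN EIGENVALUE AFTER A LINE OUTAGE IS PINCHED**:
`(1 − c(r,s)𝓡(r ↔ s))·λ↓_k(L) ≤ λ↓_k(L') ≤ λ↓_k(L)` for every `k` (Loewner monotonicity, HJ Cor.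
4.3.12, applied to §2's sandwich, with `1 − c(r,s)𝓡(r ↔ s) ≥ 0`), together with the one-line
interlacing `λ↓_{k+1}(L) ≤ λ↓_k(L')` and the shift bound `λ↓_k(L) − 2c(r,s) ≤ λ↓_k(L')` (Van Mieghem
(4.111)–(4.112), the tree's `laplacian_edgeAddition_eigenvalues₀` read for `L = L' + c(r,s)νν^ᵀ`).
[cite: SpielmanSrivastava2011, §3 Lemma 4 / Lemma 3 (arXiv:0803.0929 p0006); HornJohnson2013, Cor. 4.3.12 (Loewner monotonicity), Thm 1.1.6; VanMieghem2010, §4.7 art. 163–164 eqs. (4.111)–(4.112) (held text p0179)] -/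
theorem lineOutage_eigenvalues₀ (hc : IsConductance c) {G : SimpleGraph X}
    (hG : ∀ x y, G.Adj x y ↔ x ≠ y ∧ c x y ≠ 0) (hconn : G.Connected) {r s : X} (hrs : r ≠ s)
    (hcrs : c r s ≠ 0) {L' : Matrix X X ℝ}
    (hL' : L' = (Matrix.diagonal (nodeConductance c) - c)
        - c r s • Matrix.vecMulVec (Pi.single r (1 : ℝ) - Pi.single s 1) (Pi.single r (1 : ℝ) - Pi.single s 1))
    (hL : (Matrix.diagonal (nodeConductance c) - c).IsHermitian) (hL'h : L'.IsHermitian)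
    (k : Fin (Fintype.card X)) :
    (1 - c r s * effectiveResistance c r s) * hL.eigenvalues₀ k ≤ hL'h.eigenvalues₀ k
    ∧ hL'h.eigenvalues₀ k ≤ hL.eigenvalues₀ k
    ∧ hL.eigenvalues₀ k - 2 * c r s ≤ hL'h.eigenvalues₀ k
    ∧ (∀ hk : (k : ℕ) + 1 < Fintype.card X, hL.eigenvalues₀ ⟨k + 1, hk⟩ ≤ hL'h.eigenvalues₀ k) := by
  have hfac : 0 ≤ 1 - c r s * effectiveResistance c r s := by
    linarith [conductance_mul_effectiveResistance_le_one hc hG hconn hrs hcrs]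
  have hsL : ((1 - c r s * effectiveResistance c r s) • (Matrix.diagonal (nodeConductance c) - c)).IsHermitian := by
    rw [Matrix.IsHermitian, Matrix.conjTranspose_smul, star_trivial, hL.eq]
  have h1 : hsL.eigenvalues₀ k ≤ hL'h.eigenvalues₀ k :=
    eigenvalues₀_mono_of_form_le hsL hL'h (fun x => by
      rw [Matrix.smul_mulVec, dotProduct_smul, smul_eq_mul]
      exact (lineOutage_form_sandwich hc hG hconn hrs hL' x).1) k
  rw [eigenvalues₀_smul_of_nonneg hL hfac hsL k] at h1
  have h2 : hL'h.eigenvalues₀ k ≤ hL.eigenvalues₀ k :=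
    eigenvalues₀_mono_of_form_le hL'h hL (fun x => (lineOutage_form_sandwich hc hG hconn hrs hL' x).2) k
  -- the intact grid is the damaged grid plus the line: Van Mieghem's interlacing by name
  have hLQ : (L' + c r s • Matrix.vecMulVec (Pi.single r (1 : ℝ) - Pi.single s (1 : ℝ) : X → ℝ)
      (Pi.single r (1 : ℝ) - Pi.single s (1 : ℝ) : X → ℝ)).IsHermitian := by
    rw [hL', sub_add_cancel]; exact hL
  have h3 := laplacian_edgeAddition_eigenvalues₀ hL'h hrs (hc.nonneg r s) hLQ k
  have hcongr : hLQ.eigenvalues₀ = hL.eigenvalues₀ :=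
    eigenvalues₀_congr₁₂ hLQ hL (by rw [hL', sub_add_cancel])
  rw [hcongr] at h3
  exact ⟨h1, h2, by linarith [h3.2.1], fun hk => (h3.2.2 hk).1⟩

end Sandwich

/-! ### §3. The algebraic connectivity under an N−1 line contingency -/

section AlgConn

/-- ★★★ **THE ALGEBRAIC CONNECTIVITY AFTER A LINE OUTAGE, FROM PRE-OUTAGE DATA ALONE**: on a
connected conductance network with `n ≥ 2` nodes and `L' = L − c(r,s)ν_rsν_rsᵀ` (line `{r,s}`
removed): `(1 − c(r,s)𝓡(r ↔ s))·λ₂(L) ≤ λ₂(L') ≤ λ₂(L)`; and if `r`, `s` stay joined through the other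
lines then `c(r,s)𝓡(r ↔ s) < 1` and `λ₂(L) > 0`, so `λ₂(L') > 0` with the explicit floor — a
QUANTITATIVE weighted Fiedler statement for the damaged graph (`λ₂ > 0 ⟺` connected), computable
from the intact grid's `λ₂` and ONE effective resistance.
[cite: SpielmanSrivastava2011, §3 Lemma 4 / Lemma 3 (arXiv:0803.0929 p0006); VanMieghem2010, §4.7 art. 163–164 (4.111)–(4.112) (p0179); BrouwerHaemers2012, §1.7 (Fiedler: `μ₂ > 0 ⟺` connected); HornJohnson2013, Cor. 4.3.12] -/
theorem lineOutage_algConn (hc : IsConductance c) {G : SimpleGraph X}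
    (hG : ∀ x y, G.Adj x y ↔ x ≠ y ∧ c x y ≠ 0) (hconn : G.Connected) {r s : X} (hrs : r ≠ s)
    (hcrs : c r s ≠ 0) {L' : Matrix X X ℝ}
    (hL' : L' = (Matrix.diagonal (nodeConductance c) - c)
        - c r s • Matrix.vecMulVec (Pi.single r (1 : ℝ) - Pi.single s 1) (Pi.single r (1 : ℝ) - Pi.single s 1))
    (hL : (Matrix.diagonal (nodeConductance c) - c).IsHermitian) (hL'h : L'.IsHermitian)
    (hn : 2 ≤ Fintype.card X) :
    (1 - c r s * effectiveResistance c r s) * hL.eigenvalues₀ ⟨Fintype.card X - 2, by omega⟩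
        ≤ hL'h.eigenvalues₀ ⟨Fintype.card X - 2, by omega⟩
    ∧ hL'h.eigenvalues₀ ⟨Fintype.card X - 2, by omega⟩ ≤ hL.eigenvalues₀ ⟨Fintype.card X - 2, by omega⟩
    ∧ 0 < hL.eigenvalues₀ ⟨Fintype.card X - 2, by omega⟩
    ∧ (∀ {G' : SimpleGraph X}, (∀ x y, G'.Adj x y → c x y ≠ 0 ∧ ¬ (x = r ∧ y = s) ∧ ¬ (x = s ∧ y = r)) →
        G'.Reachable r s →
        c r s * effectiveResistance c r s < 1 ∧ 0 < hL'h.eigenvalues₀ ⟨Fintype.card X - 2, by omega⟩) := by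
  obtain ⟨h1, h2, -, -⟩ := lineOutage_eigenvalues₀ hc hG hconn hrs hcrs hL' hL hL'h ⟨Fintype.card X - 2, by omega⟩
  obtain ⟨-, hZ, hrow0⟩ := laplacian_props₁₂ hc
  have hGL : ∀ x y, G.Adj x y ↔ x ≠ y ∧ (Matrix.diagonal (nodeConductance c) - c) x y ≠ 0 := by
    intro x y
    rw [hG x y]
    constructor
    · rintro ⟨hxy, h⟩
      exact ⟨hxy, by rwa [Matrix.sub_apply, Matrix.diagonal_apply_ne _ hxy, zero_sub, neg_ne_zero]⟩
    · rintro ⟨hxy, h⟩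
      exact ⟨hxy, by rwa [Matrix.sub_apply, Matrix.diagonal_apply_ne _ hxy, zero_sub, neg_ne_zero] at h⟩
  have hpos := laplacian_eigenvalues₀_pos_of_connected hL hZ hrow0 hGL hconn hn ⟨Fintype.card X - 2, by omega⟩ le_rfl
  refine ⟨h1, h2, hpos, fun hG' hreach => ?_⟩
  have hlt := conductance_mul_effectiveResistance_lt_one hc hG hconn hrs hcrs hG' hreach
  exact ⟨hlt, lt_of_lt_of_le (mul_pos (by linarith) hpos) h1⟩

/-- ★★ **N−1 SCREENING RULE FOR A SPECTRAL CERTIFICATE**: any lower bound `λ ≤ (1 − c(r,s)𝓡(r ↔ s))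
·λ₂(L)` certified on the INTACT network is a lower bound `λ ≤ λ₂(L')` for the network with the line
`{r,s}` out — the currency of the tree's `λ ≤ λ₂` hypotheses (`pairCertificate_iff_le_algConn`,
★ `two_norm_cohesive_of_le_algConn`, `frequency_sync_of_le_algConn`).
[cite: SpielmanSrivastava2011, §3 Lemma 4 (arXiv:0803.0929 p0006 L76–L112); DorflerBullo2012, arXiv:0910.5673 §5.2 Lemma 5.9 (the certificate hypothesis `λ₂(L(aᵢⱼ))`)] -/
theorem le_lineOutage_algConn_of_le (hc : IsConductance c) {G : SimpleGraph X}
    (hG : ∀ x y, G.Adj x y ↔ x ≠ y ∧ c x y ≠ 0) (hconn : G.Connected) {r s : X} (hrs : r ≠ s)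
    (hcrs : c r s ≠ 0) {L' : Matrix X X ℝ}
    (hL' : L' = (Matrix.diagonal (nodeConductance c) - c)
        - c r s • Matrix.vecMulVec (Pi.single r (1 : ℝ) - Pi.single s 1) (Pi.single r (1 : ℝ) - Pi.single s 1))
    (hL : (Matrix.diagonal (nodeConductance c) - c).IsHermitian) (hL'h : L'.IsHermitian)
    (hn : 2 ≤ Fintype.card X) {lam : ℝ}
    (hlam : lam ≤ (1 - c r s * effectiveResistance c r s) * hL.eigenvalues₀ ⟨Fintype.card X - 2, by omega⟩) :
    lam ≤ hL'h.eigenvalues₀ ⟨Fintype.card X - 2, by omega⟩ :=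
  hlam.trans (lineOutage_algConn hc hG hconn hrs hcrs hL' hL hL'h hn).1

end AlgConn

end KronReduction

/-! ### §4. THE MODEL READING: a coupling graph whose edges are the physical lines (first-order /
droop oscillator networks) loses one line -/

section CouplingGraph

open KronReduction Literature.Probability.MarkovChains Literature.Analysis.Matrix.EigenvalueCount

variable {n : ℕ}

/-- In a connected graph on at least two nodes every node has a neighbour. [folklore] -/
private theorem exists_adj_of_connected₁₂ {V : Type*} {G : SimpleGraph V} (hconn : G.Connected)
    {x y₀ : V} (hne : x ≠ y₀) : ∃ y, G.Adj x y := by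
  obtain ⟨p⟩ := hconn.preconnected x y₀
  cases p with
  | nil => exact absurd rfl hne
  | cons hadj _ => exact ⟨_, hadj⟩

/-- ★ **A CONNECTED COUPLING GRAPH IS A CONDUCTANCE NETWORK**: symmetric non-negative weights `a` on
`n ≥ 2` oscillators whose graph `{i,j} : aᵢⱼ ≠ 0` is connected have positive total weight at every
node, so `Matrix.of a` is an `IsConductance` network and the tree's effective resistance
`𝓡_a(i ↔ j)` is available for it.
[cite: DorflerBullo2012, arXiv:0910.5673 §2 («the graph induced by `P = Pᵀ` is connected», p0005 L32–L38); LevinPeres2017, §9.1 (a network is a connected weighted graph)] -/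
theorem isConductance_of_connected_weights (hn : 2 ≤ n) (a : Fin n → Fin n → ℝ)
    (ha : ∀ i j, a i j = a j i) (ha0 : ∀ i j, 0 ≤ a i j) {G : SimpleGraph (Fin n)}
    (hG : ∀ i j, G.Adj i j ↔ i ≠ j ∧ a i j ≠ 0) (hconn : G.Connected) :
    IsConductance (Matrix.of a) := by
  refine ⟨fun i j => ha i j, fun i j => ha0 i j, fun i => ?_⟩
  obtain ⟨j₀, hj₀⟩ : ∃ j₀ : Fin n, i ≠ j₀ := by
    by_cases hi : (i : ℕ) = 0
    · exact ⟨⟨1, by omega⟩, fun h => by have := congrArg Fin.val h; simp [hi] at this⟩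
    · exact ⟨⟨0, by omega⟩, fun h => hi (by have := congrArg Fin.val h; simpa using this)⟩
  obtain ⟨j, hj⟩ := exists_adj_of_connected₁₂ hconn hj₀
  have hpos : 0 < a i j := (ha0 i j).lt_of_ne (Ne.symm ((hG i j).1 hj).2)
  exact lt_of_lt_of_le hpos (Finset.single_le_sum (fun k _ => ha0 i k) (Finset.mem_univ j))

/-- Equal matrices have equal sorted spectra. [folklore] -/
private theorem eigenvalues₀_congr₁₃ {A B : Matrix (Fin n) (Fin n) ℝ} (hA : A.IsHermitian)
    (hB : B.IsHermitian) (h : A = B) : hA.eigenvalues₀ = hB.eigenvalues₀ := by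
  subst h; rfl

/-- ★★★ **LOSING ONE LINE OF A COUPLING GRAPH: THE ALGEBRAIC CONNECTIVITY KEEPS AT LEAST THE
FRACTION `1 − aᵣₛ·𝓡_a(r ↔ s)` AND EVERY MODE IS PINCHED.**  Symmetric weights `a ≥ 0` on `n ≥ 2`
oscillators with connected coupling graph, the pair `{r,s}` (`aᵣₛ ≠ 0`) switched off (`a'ᵣₛ = a'ₛᵣ =
0`, `a' = a` elsewhere), `L = diag(a𝟙) − a`, `L' = diag(a'𝟙) − a'`, `𝓡 = 𝓡_a(r ↔ s)` the effective
resistance of the pair in the weighted coupling graph: (i) `(1 − aᵣₛ𝓡)·λ₂(L) ≤ λ₂(L') ≤ λ₂(L)`,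
`λ₂(L) > 0`; (ii) `(1 − aᵣₛ𝓡)·λ↓_k(L) ≤ λ↓_k(L') ≤ λ↓_k(L)` for every `k`; (iii) SCREENING: every
`λ ≤ (1 − aᵣₛ𝓡)λ₂(L)` satisfies `λ ≤ λ₂(L')`, i.e. may be fed to ★ `two_norm_cohesive_of_le_algConn` /
`frequency_sync_of_le_algConn` / `DroopNetwork.two_norm_cohesive_of_le_algConn` for the damaged
network.  MODEL READING: for oscillator networks whose coupling graph IS the line graph (first-order
non-uniform Kuramoto / lossless all-inverter droop network, `aᵢⱼ = EᵢEⱼ|Yᵢⱼ|`), synchronization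
condition II survives the outage of line `{r,s}` whenever `λ_critical < (1 − aᵣₛ𝓡)·λ₂(L)` — an N−1
screen using the intact network only.  (For NETWORK-REDUCED models a physical line outage is the dense
rank-one update of ★ `kronReducedSusceptance_eigenvalues₀_line_outage`, not a single deleted
coupling.)  `0 < 1 − aᵣₛ𝓡` off bridges is `conductance_mul_effectiveResistance_lt_one`.
[cite: SpielmanSrivastava2011, §3 Lemma 4 / Lemma 3 (arXiv:0803.0929 p0006); DorflerBullo2012, arXiv:0910.5673 §5.2 Thm 5.5 / Lemma 5.9 («if `λ₂(L(Pᵢⱼ cos φᵢⱼ)) > λ_critical`»); VanMieghem2010, §4.7 art. 163–164 (p0179); HornJohnson2013, Cor. 4.3.12] -/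
theorem couplingLaplacian_lineOutage_algConn (hn : 2 ≤ n) {a a' : Fin n → Fin n → ℝ}
    (ha : ∀ i j, a i j = a j i) (ha0 : ∀ i j, 0 ≤ a i j) {G : SimpleGraph (Fin n)}
    (hG : ∀ i j, G.Adj i j ↔ i ≠ j ∧ a i j ≠ 0) (hconn : G.Connected) {r s : Fin n} (hrs : r ≠ s)
    (hars : a r s ≠ 0)
    (ha' : ∀ i j, a' i j = if (i = r ∧ j = s) ∨ (i = s ∧ j = r) then 0 else a i j)
    (hL : (diagonal (fun i => ∑ j, a i j) - Matrix.of a).IsHermitian)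
    (hL' : (diagonal (fun i => ∑ j, a' i j) - Matrix.of a').IsHermitian) :
    ((1 - a r s * effectiveResistance (Matrix.of a) r s) * hL.eigenvalues₀ ⟨n - 2, by simp; omega⟩
        ≤ hL'.eigenvalues₀ ⟨n - 2, by simp; omega⟩
      ∧ hL'.eigenvalues₀ ⟨n - 2, by simp; omega⟩ ≤ hL.eigenvalues₀ ⟨n - 2, by simp; omega⟩
      ∧ 0 < hL.eigenvalues₀ ⟨n - 2, by simp; omega⟩)
    ∧ (∀ k, (1 - a r s * effectiveResistance (Matrix.of a) r s) * hL.eigenvalues₀ k ≤ hL'.eigenvalues₀ k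
        ∧ hL'.eigenvalues₀ k ≤ hL.eigenvalues₀ k)
    ∧ (∀ lam : ℝ, lam ≤ (1 - a r s * effectiveResistance (Matrix.of a) r s) * hL.eigenvalues₀ ⟨n - 2, by simp; omega⟩ →
        lam ≤ hL'.eigenvalues₀ ⟨n - 2, by simp; omega⟩) := by
  have hc : IsConductance (Matrix.of a) := isConductance_of_connected_weights hn a ha ha0 hG hconn
  have hGc : ∀ i j, G.Adj i j ↔ i ≠ j ∧ Matrix.of a i j ≠ 0 := hG
  -- the damaged coupling Laplacian is the rank-one downdate of the intact one
  have hupd := ClassicalModel.laplacian_lineOutage_eq hc hrs (c' := Matrix.of a')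
    (by rw [Matrix.of_apply, ha', if_pos (Or.inl ⟨rfl, rfl⟩)])
    (by rw [Matrix.of_apply, ha', if_pos (Or.inr ⟨rfl, rfl⟩)])
    (fun x y h1 h2 => by rw [Matrix.of_apply, Matrix.of_apply, ha', if_neg (not_or.2 ⟨h1, h2⟩)])
  have heqL : diagonal (fun i => ∑ j, a i j) - Matrix.of a
      = Matrix.diagonal (nodeConductance (Matrix.of a)) - Matrix.of a := rfl
  have heqL' : diagonal (fun i => ∑ j, a' i j) - Matrix.of a'
      = Matrix.diagonal (nodeConductance (Matrix.of a')) - Matrix.of a' := rfl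
  have hLc : (Matrix.diagonal (nodeConductance (Matrix.of a)) - Matrix.of a).IsHermitian := heqL ▸ hL
  have hL'c : (Matrix.diagonal (nodeConductance (Matrix.of a')) - Matrix.of a').IsHermitian := heqL' ▸ hL'
  have hn' : 2 ≤ Fintype.card (Fin n) := by simpa using hn
  have hev : hLc.eigenvalues₀ = hL.eigenvalues₀ := eigenvalues₀_congr₁₃ hLc hL heqL.symm
  have hev' : hL'c.eigenvalues₀ = hL'.eigenvalues₀ := eigenvalues₀_congr₁₃ hL'c hL' heqL'.symm
  have hidx : (⟨Fintype.card (Fin n) - 2, by omega⟩ : Fin (Fintype.card (Fin n))) = ⟨n - 2, by simp; omega⟩ :=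
    Fin.ext (by simp)
  have hmain := lineOutage_algConn hc hGc hconn hrs hars hupd hLc hL'c hn'
  rw [hev, hev', hidx] at hmain
  have hall := fun k => lineOutage_eigenvalues₀ hc hGc hconn hrs hars hupd hLc hL'c k
  simp only [hev, hev'] at hall
  refine ⟨⟨hmain.1, hmain.2.1, hmain.2.2.1⟩, fun k => ⟨(hall k).1, (hall k).2.1⟩, fun lam hlam => ?_⟩
  exact hlam.trans hmain.1

end CouplingGraph

end Literature.MathematicalPhysics.PowerSystems

end
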